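import Summits.HodgeConjecture.HodgeConjecture.Theses.HolomorphicityRate
import Literature.AlgebraicGeometry.HodgeTheory.AnalyticSupport
import Literature.AlgebraicGeometry.HodgeTheory.LefschetzOneOneChowClosed
import Literature.AlgebraicGeometry.HodgeTheory.SupportedHodgeClassesAlgebraic
import Literature.AlgebraicGeometry.HodgeTheory.HodgeModelConnected
import Literature.AlgebraicGeometry.HodgeTheory.LefschetzOneOne
import Literature.AlgebraicGeometry.Motives.AbstractHodgeTate
import Literature.AlgebraicGeometry.Motives.VarietiesProperProofs
import Literature.NumberTheory.Transcendental.AnalytificationConnected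

/-!
# Route HolomorphicityRate — the `p = 1` model of `SuperThresholdRigidity` (item
# `LefschetzNewtonModel`, stmt-HodgeConjecture-2902): where the answer is known, it is Lefschetz

Support item `LefschetzNewtonModel` of route `route-HodgeConjecture-HolomorphicityRate` is the
`p = 1` MODEL of the crux `SuperThresholdRigidity` (R2): for `X` smooth projective, a rational Hodge
class `c ∈ H²(X, ℚ) ∩ H^{1,1}` and the rate-`1` representatives of `UniversalRateOne`, the
Newton–Kuranishi scheme over the zero loci should converge to a complex hypersurface in the class
`m•c + a_k•h` — "the test where the answer is known".  The item is filed informally (no Lean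
signature in the Theses file).  This file records, kernel-checked, the part of it the tree can
state: **the CONCLUSION of R2 in codimension `p = 1` holds for every rational `(1,1)` class, for
every `k`, by Lefschetz's theorem on `(1,1)`-classes** — no nearly-holomorphic representative and
no Newton scheme is needed to reach R2's output (a closed analytic support all of whose regular
points have codimension `≥ 1`), which is exactly why `p = 1` is the calibration case of the route.

* `map_compl_pullback_eq_zero_of_restrictCompl_eq_zero` — transport `X(ℂ) → X^an`: a class dying
  on `(X ∖ Z)(ℂ)` has pull-back dying on `X^an ∖ φ⁻¹(Z(ℂ))` (converse of the tree's
  `restrictCompl_eq_zero_of_pullback`).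
* `isAnalyticallySupported_one_of_mem_algebraicClasses` — **algebraic divisor classes are
  analytically supported in codimension `≥ 1`** on every Hodge model (GAGA §5: `Z(ℂ)` is analytic,
  `isAnalyticSet_preimage_setOf_pt_mem`; `Z ≠ X` because the generic point has codimension `0`, so
  some complex point misses `Z`, Nullstellensatz; proper analytic subsets of the connected `X^an`
  have codimension `≥ 1` at regular points, `isAnalyticallySupported_of_ne_univ`).  Unconditional.
* `isAnalyticallySupported_one_of_isRationalClass_of_mem_hodgePQ` — rational `(1,1)` classes are
  analytically supported in codimension `≥ 1`, from the named fact `lefschetzOneOne_rational`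
  (Voisin I, Thm. 11.30 + Cor. 11.34; in the tree reduced to GAGA for line bundles,
  `lefschetzOneOne_rational_of_serreGAGA`).
* `superThresholdRigidity_of_eq_one_of_mem_hodgePQ` — the text of `SuperThresholdRigidity`
  verbatim with `p = 1` and the two extra hypotheses "`c` rational, `A^* c ∈ H^{1,1}(A)`": its
  conclusion holds (with ANY `k`), conditional on `lefschetzOneOne_rational` only.
* `superThresholdRigidity_of_eq_one_of_isRationalClass` — the same with ONLY "`c` rational" added,
  from `ThresholdForcesHodgeType` (E2, route decl, which supplies the `(1,1)` type: the
  super-threshold defect `C' k^{-(1+δ)}` has `t_k · k → 0`) and `lefschetzOneOne_rational`.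
* `target_of_eq_one` — the `p = 1` instance of the route target `Target` (X₀), from
  `lefschetzOneOne_rational` (`m = 1`, `b = 0`).

What is NOT here: the informal content of the item (convergence of the Newton–Kuranishi iteration,
`H^{0,2}`-pinned cokernel, smoothness of the limiting hypersurface = Bertini–Serre) has no carrier
in the tree; R2 at `p = 1` for NON-rational complex classes `c` needs the Thom-class integrality
`m•c + a_k•hp ∈ ℂ • [S_k]` of nearly holomorphic supports, also absent.
Prover seat prover-pitem-stmt-HodgeConjecture-2902-0, 2026-08-16.

## References

* C. Voisin, *Hodge Theory and Complex Algebraic Geometry I* (2002), Thm. 11.30, Cor. 11.34,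
  §11.1.2, §11.3.2. [VoisinHodgeI2002]
* J.-P. Serre, *Géométrie algébrique et géométrie analytique* (1956), §2 n°5 Lemme 1 b), §5.
  [SerreGAGA1956]
-/

noncomputable section

open scoped Manifold ContDiff Topology
open Set Filter

-- `Summit.HodgeConjecture.HodgeConjecture.Theorems` is the mandated namespace (single-conjunct summit:
-- Sub = Summit), which `linter.dupNamespace` flags on every declaration; the lakefile turns the
-- linter off tree-wide (weak option), restated here so stand-alone elaboration is warning-free too.
set_option linter.dupNamespace false

namespace Summit.HodgeConjecture.HodgeConjecture.Theorems

open Literature.AlgebraicGeometry.HodgeTheory Literature.AlgebraicGeometry.Motives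
  Literature.AlgebraicTopology.SingularHomology Literature.Geometry.Kaehler
  Summit.HodgeConjecture.HodgeConjecture.Theses.HolomorphicityRate

variable {n : ℕ} {X : Literature.AlgebraicGeometry.Motives.SchemeOver ℂ}

/-! ### Transport `X(ℂ) → X^an` and algebraic divisor classes -/

/-- **Transport of vanishing from `(X ∖ Z)(ℂ)` to the Hodge model.** If `S = φ⁻¹(Z(ℂ))` for the
comparison map `φ : X^an → X(ℂ)` of a Hodge model `A`, a class `x ∈ Hᵏ(X(ℂ); ℂ)` dying on
`(X ∖ Z)(ℂ)` has pull-back `φ^* x` dying on `X^an ∖ S`: `φ` restricts to a map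
`X^an ∖ S → (X ∖ Z)(ℂ)` over the inclusions (converse companion of the tree's
`restrictCompl_eq_zero_of_pullback`). [cite: SerreGAGA1956, §5] -/
theorem map_compl_pullback_eq_zero_of_restrictCompl_eq_zero (A : HodgeModel n X) {k : ℕ}
    {Z : Set X.left} {S : Set A.carrier} (hSZ : S = A.toComplexPoints ⁻¹' {P | P.pt ∈ Z})
    (x : complexBetti X k) (hx : complexBetti.restrictCompl X Z k x = 0) :
    singularCohomology.map ℂ ℂ
      (⟨Subtype.val, continuous_subtype_val⟩ : C({m : A.carrier // m ∉ S}, A.carrier)) k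
        (A.pullback k x) = 0 := by
  have hiff : ∀ m : A.carrier, m ∉ S → (A.toComplexPoints m).pt ∉ Z := fun m hm h =>
    hm (by rw [hSZ]; exact h)
  -- `φ` restricted to the complements
  let j : C({m : A.carrier // m ∉ S}, complexPointsCompl X Z) :=
    ⟨fun m => ⟨A.toComplexPoints m.1, hiff m.1 m.2⟩,
      (A.isAnalytification.isHomeomorph.continuous.comp continuous_subtype_val).subtype_mk _⟩
  set φC : C(A.carrier, ComplexPoints X) :=
    ⟨A.toComplexPoints, A.isAnalytification.isHomeomorph.continuous⟩
  set incl : C({m : A.carrier // m ∉ S}, A.carrier) := ⟨Subtype.val, continuous_subtype_val⟩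
  set inclZ : C(complexPointsCompl X Z, ComplexPoints X) := ⟨Subtype.val, continuous_subtype_val⟩
  have hsq : φC.comp incl = inclZ.comp j := by
    ext m
    rfl
  -- `incl^* ∘ φ^* = (φ ∘ incl)^* = (inclZ ∘ j)^* = j^* ∘ inclZ^*`
  have e1 := ModuleCat.comp_apply (singularCohomology.map ℂ ℂ φC k)
    (singularCohomology.map ℂ ℂ incl k) x
  have e2 := ModuleCat.comp_apply (singularCohomology.map ℂ ℂ inclZ k)
    (singularCohomology.map ℂ ℂ j k) x
  rw [← singularCohomology.map_comp, hsq, singularCohomology.map_comp] at e1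
  have e3 : singularCohomology.map ℂ ℂ incl k (A.pullback k x) =
      singularCohomology.map ℂ ℂ j k (complexBetti.restrictCompl X Z k x) := e1.symm.trans e2
  rw [e3]
  exact (congrArg (singularCohomology.map ℂ ℂ j k) hx).trans (map_zero _)

/-- **Algebraic divisor classes are analytically supported in codimension `≥ 1`.** For `X` smooth
projective of dimension `n` over `ℂ`, every Hodge model `A` and every
`c ∈ algebraicClasses X 1 = N¹ H²(X(ℂ); ℂ)`, the class `c` is analytically supported in
codimension `≥ 1` on `A` (`IsAnalyticallySupported A 1 c`): `c` dies off a Zariski-closed `Z` of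
codimension `≥ 1` (`mem_supportedClasses_iff_exists`); `S = φ⁻¹(Z(ℂ))` is a closed analytic
subset of `X^an` (GAGA §5 / §2 n°5 Lemme 1 b), `isAnalyticSet_preimage_setOf_pt_mem`); `Z` misses
the generic point (codimension `0`), hence misses a complex point (Nullstellensatz,
`ComplexPoints.exists_pt_mem`), so `S ≠ X^an`; and `φ^* c` dies on `X^an ∖ S`
(`map_compl_pullback_eq_zero_of_restrictCompl_eq_zero`).  A proper analytic subset of the
connected `X^an` has codimension `≥ 1` at its regular points (`isAnalyticallySupported_of_ne_univ`).
[cite: SerreGAGA1956, §2 n°5 Lemme 1 b) and §5] [cite: VoisinHodgeI2002, §11.1.2] -/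
theorem isAnalyticallySupported_one_of_mem_algebraicClasses (hX : IsSmoothProjective n X)
    (A : HodgeModel n X) {c : complexBetti X (2 * 1)} (hc : c ∈ algebraicClasses X 1) :
    IsAnalyticallySupported A 1 c := by
  haveI : AlgebraicGeometry.IsProper X.hom := IsSmoothProjective.isProper_holds hX
  haveI : ConnectedSpace A.carrier := A.connectedSpace_carrier hX
  haveI : IrreducibleSpace X.left := hX.irreducibleSpace
  obtain ⟨Z, hZ, hcoh, h0⟩ := mem_supportedClasses_iff_exists.1 hc
  -- the generic point of `X` has codimension `0`, so it is not in `Z`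
  have hη : genericPoint X.left ∉ Z := fun h => by
    have h1 := hcoh _ h
    rw [coheight_eq_zero_of_isGenericPoint_univ (genericPoint_spec X.left)] at h1
    exact absurd h1 (by simp)
  -- hence some complex point `P` misses `Z`
  obtain ⟨P, hP⟩ := ComplexPoints.exists_pt_mem (X := X) (Z := Zᶜ) ⟨_, hη⟩
    hZ.isOpen_compl.isLocallyClosed
  refine isAnalyticallySupported_of_ne_univ (S := A.toComplexPoints ⁻¹' {P | P.pt ∈ Z})
    (isAnalyticSet_preimage_setOf_pt_mem A.isAnalytification hZ) ?_
    (map_compl_pullback_eq_zero_of_restrictCompl_eq_zero A rfl c h0)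
  -- `S ≠ X^an`: the point of `X^an` over `P` is not in `S`
  intro hSu
  have hmem : A.isAnalytification.homeomorph.symm P ∈ A.toComplexPoints ⁻¹' {P | P.pt ∈ Z} :=
    hSu ▸ mem_univ _
  rw [mem_preimage, mem_setOf_eq] at hmem
  have hφ : A.toComplexPoints (A.isAnalytification.homeomorph.symm P) = P :=
    A.isAnalytification.homeomorph.apply_symm_apply P
  rw [hφ] at hmem
  exact hP hmem

/-- On the Kodaira ray: for `c ∈ N¹ H²` and `hp ∈ N¹ H²`, every ray class `m•c + a_k•hp` is
analytically supported in codimension `≥ 1`, for every `k` (`N¹` is a `ℂ`-submodule).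
[cite: VoisinHodgeI2002, §11.1.2] -/
theorem isAnalyticallySupported_one_ray_of_mem_algebraicClasses (hX : IsSmoothProjective n X)
    (A : HodgeModel n X) {c hp : complexBetti X (2 * 1)} (hc : c ∈ algebraicClasses X 1)
    (halg : hp ∈ algebraicClasses X 1) (m : ℕ) (a : ℕ → ℕ) (k : ℕ) :
    IsAnalyticallySupported A 1 ((m : ℂ) • c + ((a k : ℕ) : ℂ) • hp) :=
  isAnalyticallySupported_one_of_mem_algebraicClasses hX A
    (Submodule.add_mem _ (Submodule.smul_mem _ _ hc) (Submodule.smul_mem _ _ halg))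

/-! ### Rational `(1,1)` classes: Lefschetz -/

/-- **Rational `(1,1)` classes are analytically supported in codimension `≥ 1`** (the support form
of Lefschetz's theorem on `(1,1)`-classes): for `X` smooth projective, a Hodge model `A` and a
rational `c ∈ H²(X(ℂ); ℂ)` with `A^* c ∈ H^{1,1}(A)`, the class `c` dies off a closed analytic
subset of `X^an` of codimension `≥ 1`.  Conditional on the named fact `lefschetzOneOne_rational`
(Voisin I, Thm. 11.30 with Cor. 11.34; in the tree `lefschetzOneOne_rational_of_serreGAGA` reduces
it to GAGA for line bundles), followed by `isAnalyticallySupported_one_of_mem_algebraicClasses`.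
[cite: VoisinHodgeI2002, Thm. 11.30, Cor. 11.34 and §11.3.2] -/
theorem isAnalyticallySupported_one_of_isRationalClass_of_mem_hodgePQ
    (hL : lefschetzOneOne_rational) (hX : IsSmoothProjective n X) (A : HodgeModel n X)
    {c : complexBetti X (2 * 1)} (hc : IsRationalClass c)
    (h11 : A.pullback (2 * 1) c ∈ A.hodgePQ (2 * 1) 1 1) : IsAnalyticallySupported A 1 c :=
  isAnalyticallySupported_one_of_mem_algebraicClasses hX A (hL hX c hc ⟨A, h11⟩)

/-! ### The `p = 1` instances of `SuperThresholdRigidity` and `Target` -/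

/-- **`SuperThresholdRigidity` for `p = 1` and rational `(1,1)` classes (the Lefschetz model).**
The text of the route decl `SuperThresholdRigidity` verbatim, with the extra hypotheses `p = 1`,
"`c` rational" and "`A^* c ∈ H^{p,p}(A)`" (the setting of item `LefschetzNewtonModel`: a Hodge
class `c ∈ H²(X, ℚ) ∩ H^{1,1}`): the conclusion — some ray class `m•c + a_k•hp` dies off a closed
analytic subset of `X^an` all of whose regular points have codimension `≥ 1` — holds, and in fact
for `k = 0` (indeed every `k`, `isAnalyticallySupported_one_ray_of_mem_algebraicClasses`), without
using the nearly holomorphic representatives: `m•c + a_k•hp ∈ N¹ H²` by Lefschetz `(1,1)` and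
`hp ∈ N¹`, and `N¹`-classes are analytically supported.  Conditional on `lefschetzOneOne_rational`.
[cite: VoisinHodgeI2002, Thm. 11.30, Cor. 11.34 and §11.3.2] -/
theorem superThresholdRigidity_of_eq_one_of_mem_hodgePQ (hL : lefschetzOneOne_rational)
    (n p : ℕ) (X : Literature.AlgebraicGeometry.Motives.SchemeOver ℂ)
    (hX : Literature.AlgebraicGeometry.Motives.IsSmoothProjective n X) (_hpn : p ≤ n) (hp1 : p = 1)
    (A : Literature.AlgebraicGeometry.HodgeTheory.HodgeModel n X)
    (g : Bundle.ContMDiffRiemannianMetric 𝓘(ℝ, A.model) ((⊤ : ℕ∞) : WithTop ℕ∞) A.model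
      (fun x : A.carrier => TangentSpace 𝓘(ℝ, A.model) x))
    (c hp : Literature.AlgebraicGeometry.HodgeTheory.complexBetti X (2 * p)) (m : ℕ) (C : ℝ)
    (a : ℕ → ℕ) (δ C' : ℝ) (hc : Literature.AlgebraicGeometry.HodgeTheory.IsRationalClass c)
    (h11 : A.pullback (2 * p) c ∈ A.hodgePQ (2 * p) p p) :
    Literature.AlgebraicGeometry.HodgeTheory.IsRationalClass hp → hp ∈ Literature.AlgebraicGeometry.HodgeTheory.algebraicClasses X p → 0 < m → (∀ k, (a k : ℝ) ≤ C * (k : ℝ) ^ p) → 0 < δ → (∃ᶠ k : ℕ in Filter.atTop, ∃ S Sg : Set A.carrier, (IsClosed S ∧ IsClosed Sg ∧ Sg ⊆ S ∧ IsConnected (S \ Sg) ∧ (∀ x ∈ Sg, Literature.Geometry.Kaehler.IsAnalyticSetAt 𝓘(ℂ, A.model) S x) ∧ (∃ T : Set A.carrier, Sg ⊆ T ∧ (Literature.Geometry.Kaehler.IsAnalyticSet 𝓘(ℂ, A.model) T ∧ ∀ x ∈ Literature.Geometry.Kaehler.regularLocus 𝓘(ℂ, A.model) T, ∀ q : ℕ,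 Literature.Geometry.Kaehler.IsRegularPointOfCodim 𝓘(ℂ, A.model) T q x → p + 1 ≤ q)) ∧ (∀ x ∈ S \ Sg, ∃ U : Set A.carrier, IsOpen U ∧ x ∈ U ∧ ∃ f : A.carrier → (Fin (2 * p) → ℝ), ContMDiffOn 𝓘(ℝ, A.model) 𝓘(ℝ, Fin (2 * p) → ℝ) 1 f U ∧ S ∩ U = U ∩ f ⁻¹' {0} ∧ Function.Surjective (mfderiv 𝓘(ℝ, A.model) 𝓘(ℝ, Fin (2 * p) → ℝ) f x) ∧ ∀ v : TangentSpace 𝓘(ℝ, A.model) x, mfderiv 𝓘(ℝ, A.model) 𝓘(ℝ, Fin (2 * p) → ℝ) f x v = 0 → ∃ w : TangentSpace 𝓘(ℝ, A.model) x, mfderiv 𝓘(ℝ, A.model) 𝓘(ℝ, Fin (2 * p) → ℝ) f x w = 0 ∧ g.inner x (Literature.Geometry.Kaehler.tangentJ A.model x v - w) (Literature.Geometry.Kaehler.tangentJ A.model x v - w) ≤ (C' * (k : ℝ) ^ (-((p : ℝ) + δ))) ^ 2 * g.inner x v v)) ∧ Literature.AlgebraicTopology.SingularHomology.singularCohomology.map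 ℂ ℂ (⟨Subtype.val, continuous_subtype_val⟩ : C({x : A.carrier // x ∉ S}, A.carrier)) (2 * p) (A.pullback (2 * p) (((m : ℂ) • c + ((a k : ℕ) : ℂ) • hp))) = 0) → ∃ (k : ℕ) (S : Set A.carrier), (Literature.Geometry.Kaehler.IsAnalyticSet 𝓘(ℂ, A.model) S ∧ ∀ x ∈ Literature.Geometry.Kaehler.regularLocus 𝓘(ℂ, A.model) S, ∀ q : ℕ, Literature.Geometry.Kaehler.IsRegularPointOfCodim 𝓘(ℂ, A.model) S q x → p ≤ q) ∧ Literature.AlgebraicTopology.SingularHomology.singularCohomology.map ℂ ℂ (⟨Subtype.val, continuous_subtype_val⟩ : C({x : A.carrier // x ∉ S}, A.carrier)) (2 * p) (A.pullback (2 * p) (((m : ℂ) • c + ((a k : ℕ) : ℂ) • hp))) = 0 := by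
  subst hp1
  intro _ halg _ _ _ _
  obtain ⟨S, hS, h0⟩ := isAnalyticallySupported_one_ray_of_mem_algebraicClasses hX A
    (hL hX c hc ⟨A, h11⟩) halg m a 0
  exact ⟨0, S, hS, h0⟩

/-- `C' k^{-(1+δ)} · k¹ → 0` as `k → ∞` for `δ > 0`: the super-threshold defect of
`SuperThresholdRigidity` at `p = 1` satisfies the hypothesis `t_k · kᵖ → 0` of
`ThresholdForcesHodgeType`. [folklore] -/
theorem tendsto_superThreshold_defect_mul_pow_one (C' δ : ℝ) (hδ : 0 < δ) :
    Filter.Tendsto (fun k : ℕ => C' * (k : ℝ) ^ (-(((1 : ℕ) : ℝ) + δ)) * (k : ℝ) ^ (1 : ℕ))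
      Filter.atTop (nhds 0) := by
  have hlim : Filter.Tendsto (fun k : ℕ => C' * (k : ℝ) ^ (-δ)) Filter.atTop (nhds 0) := by
    have h := (tendsto_rpow_neg_atTop hδ).comp tendsto_natCast_atTop_atTop
    simpa using h.const_mul C'
  refine hlim.congr' ?_
  filter_upwards [Filter.eventually_gt_atTop 0] with k hk
  have hk' : (k : ℝ) ≠ 0 := by exact_mod_cast hk.ne'
  rw [pow_one, mul_assoc, ← Real.rpow_add_one hk']
  congr 2
  push_cast
  ring

/-- **`SuperThresholdRigidity` for `p = 1` and rational classes, from E2 and Lefschetz.** The text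
of `SuperThresholdRigidity` verbatim with the extra hypotheses `p = 1` and "`c` rational": the
super-threshold representatives (defect `≤ C' k^{-(1+δ)}`, so `t_k · k → 0`,
`tendsto_superThreshold_defect_mul_pow_one`) force `A^* c ∈ H^{1,1}(A)` by the threshold lemma
`ThresholdForcesHodgeType` (E2, route decl taken as hypothesis), and then the Lefschetz model
`superThresholdRigidity_of_eq_one_of_mem_hodgePQ` concludes.  So at `p = 1`, granted E2, R2
reduces to Lefschetz `(1,1)` for rational classes; what R2 asserts beyond that at `p = 1` concerns
non-rational complex classes only.  Conditional on `lefschetzOneOne_rational`.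
[cite: VoisinHodgeI2002, Thm. 11.30, Cor. 11.34 and §11.3.2] -/
theorem superThresholdRigidity_of_eq_one_of_isRationalClass (hE2 : ThresholdForcesHodgeType)
    (hL : lefschetzOneOne_rational)
    (n p : ℕ) (X : Literature.AlgebraicGeometry.Motives.SchemeOver ℂ)
    (hX : Literature.AlgebraicGeometry.Motives.IsSmoothProjective n X) (hpn : p ≤ n) (hp1 : p = 1)
    (A : Literature.AlgebraicGeometry.HodgeTheory.HodgeModel n X)
    (g : Bundle.ContMDiffRiemannianMetric 𝓘(ℝ, A.model) ((⊤ : ℕ∞) : WithTop ℕ∞) A.model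
      (fun x : A.carrier => TangentSpace 𝓘(ℝ, A.model) x))
    (c hp : Literature.AlgebraicGeometry.HodgeTheory.complexBetti X (2 * p)) (m : ℕ) (C : ℝ)
    (a : ℕ → ℕ) (δ C' : ℝ) (hc : Literature.AlgebraicGeometry.HodgeTheory.IsRationalClass c) :
    Literature.AlgebraicGeometry.HodgeTheory.IsRationalClass hp → hp ∈ Literature.AlgebraicGeometry.HodgeTheory.algebraicClasses X p → 0 < m → (∀ k, (a k : ℝ) ≤ C * (k : ℝ) ^ p) → 0 < δ → (∃ᶠ k : ℕ in Filter.atTop, ∃ S Sg : Set A.carrier, (IsClosed S ∧ IsClosed Sg ∧ Sg ⊆ S ∧ IsConnected (S \ Sg) ∧ (∀ x ∈ Sg, Literature.Geometry.Kaehler.IsAnalyticSetAt 𝓘(ℂ, A.model) S x) ∧ (∃ T : Set A.carrier, Sg ⊆ T ∧ (Literature.Geometry.Kaehler.IsAnalyticSet 𝓘(ℂ, A.model) T ∧ ∀ x ∈ Literature.Geometry.Kaehler.regularLocus 𝓘(ℂ, A.model) T, ∀ q : ℕ, Literature.Geometry.Kaehler.IsRegularPointOfCodim 𝓘(ℂ,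 A.model) T q x → p + 1 ≤ q)) ∧ (∀ x ∈ S \ Sg, ∃ U : Set A.carrier, IsOpen U ∧ x ∈ U ∧ ∃ f : A.carrier → (Fin (2 * p) → ℝ), ContMDiffOn 𝓘(ℝ, A.model) 𝓘(ℝ, Fin (2 * p) → ℝ) 1 f U ∧ S ∩ U = U ∩ f ⁻¹' {0} ∧ Function.Surjective (mfderiv 𝓘(ℝ, A.model) 𝓘(ℝ, Fin (2 * p) → ℝ) f x) ∧ ∀ v : TangentSpace 𝓘(ℝ, A.model) x, mfderiv 𝓘(ℝ, A.model) 𝓘(ℝ, Fin (2 * p) → ℝ) f x v = 0 → ∃ w : TangentSpace 𝓘(ℝ, A.model) x, mfderiv 𝓘(ℝ, A.model) 𝓘(ℝ, Fin (2 * p) → ℝ) f x w = 0 ∧ g.inner x (Literature.Geometry.Kaehler.tangentJ A.model x v - w) (Literature.Geometry.Kaehler.tangentJ A.model x v - w) ≤ (C' * (k : ℝ) ^ (-((p : ℝ) + δ))) ^ 2 * g.inner x v v)) ∧ Literature.AlgebraicTopology.SingularHomology.singularCohomology.map ℂ ℂ (⟨Subtype.val, continuous_subtype_val⟩ : C({x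 : A.carrier // x ∉ S}, A.carrier)) (2 * p) (A.pullback (2 * p) (((m : ℂ) • c + ((a k : ℕ) : ℂ) • hp))) = 0) → ∃ (k : ℕ) (S : Set A.carrier), (Literature.Geometry.Kaehler.IsAnalyticSet 𝓘(ℂ, A.model) S ∧ ∀ x ∈ Literature.Geometry.Kaehler.regularLocus 𝓘(ℂ, A.model) S, ∀ q : ℕ, Literature.Geometry.Kaehler.IsRegularPointOfCodim 𝓘(ℂ, A.model) S q x → p ≤ q) ∧ Literature.AlgebraicTopology.SingularHomology.singularCohomology.map ℂ ℂ (⟨Subtype.val, continuous_subtype_val⟩ : C({x : A.carrier // x ∉ S}, A.carrier)) (2 * p) (A.pullback (2 * p) (((m : ℂ) • c + ((a k : ℕ) : ℂ) • hp))) = 0 := by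
  intro hrat halg hm hbud hδ hfreq
  have h11 : A.pullback (2 * p) c ∈ A.hodgePQ (2 * p) p p := by
    subst hp1
    exact hE2 n 1 X hX hpn A g c hp m C a (fun k : ℕ => C' * (k : ℝ) ^ (-(((1 : ℕ) : ℝ) + δ)))
      hrat halg hm hbud (tendsto_superThreshold_defect_mul_pow_one C' δ hδ) hfreq
  exact superThresholdRigidity_of_eq_one_of_mem_hodgePQ hL n p X hX hpn hp1 A g c hp m C a δ C' hc
    h11 hrat halg hm hbud hδ hfreq

/-- **`Target` (X₀) for `p = 1`, from Lefschetz.** The text of the route target `Target` verbatim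
with the extra hypothesis `p = 1`: for a rational class `c` with `A^* c ∈ H^{1,1}(A)`, some multiple
`m•c` plus an algebraic `b` dies off a closed analytic subset of codimension `≥ 1` — with `m = 1`,
`b = 0`, by `isAnalyticallySupported_one_of_isRationalClass_of_mem_hodgePQ`.  Conditional on
`lefschetzOneOne_rational`. [cite: VoisinHodgeI2002, Thm. 11.30, Cor. 11.34 and §11.3.2] -/
theorem target_of_eq_one (hL : lefschetzOneOne_rational)
    (n p : ℕ) (X : Literature.AlgebraicGeometry.Motives.SchemeOver ℂ)
    (hX : Literature.AlgebraicGeometry.Motives.IsSmoothProjective n X) (_hpn : p ≤ n) (hp1 : p = 1)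
    (A : Literature.AlgebraicGeometry.HodgeTheory.HodgeModel n X)
    (c : Literature.AlgebraicGeometry.HodgeTheory.complexBetti X (2 * p))
    (hc : Literature.AlgebraicGeometry.HodgeTheory.IsRationalClass c)
    (h11 : A.pullback (2 * p) c ∈ A.hodgePQ (2 * p) p p) :
    ∃ (m : ℕ) (b : Literature.AlgebraicGeometry.HodgeTheory.complexBetti X (2 * p)) (S : Set A.carrier), 0 < m ∧ b ∈ Literature.AlgebraicGeometry.HodgeTheory.algebraicClasses X p ∧ (Literature.Geometry.Kaehler.IsAnalyticSet 𝓘(ℂ, A.model) S ∧ ∀ x ∈ Literature.Geometry.Kaehler.regularLocus 𝓘(ℂ, A.model) S, ∀ q : ℕ, Literature.Geometry.Kaehler.IsRegularPointOfCodim 𝓘(ℂ, A.model) S q x → p ≤ q) ∧ Literature.AlgebraicTopology.SingularHomology.singularCohomology.map ℂ ℂ (⟨Subtype.val, continuous_subtype_val⟩ : C({x : A.carrier // x ∉ S}, A.carrier)) (2 * p) (A.pullback (2 * p) ((m : ℂ) • c + b)) = 0 := by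
  subst hp1
  obtain ⟨S, hS, h0⟩ :=
    isAnalyticallySupported_one_of_isRationalClass_of_mem_hodgePQ hL hX A hc h11
  refine ⟨1, 0, S, one_pos, Submodule.zero_mem _, hS, ?_⟩
  simpa using h0

end Summit.HodgeConjecture.HodgeConjecture.Theorems

end
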